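import Summits.BirchSwinnertonDyer.Rank1Residual.AdditivePotMult.Descent
import Literature.NumberTheory.EllipticCurves.QuadraticTwistTateFormProofs
import Literature.NumberTheory.EllipticCurves.QuadraticTwistJInvariantProofs
import Literature.NumberTheory.EllipticCurves.NeronLocalHeightCompletion
import Literature.NumberTheory.EllipticCurves.RootNumberProofs
import Literature.NumberTheory.EllipticCurves.BSDSelmerSkinnerThmBProofs
import Literature.NumberTheory.EllipticCurves.Rank1Residual.GVParityTwistProofs
import HarnessLib

/-!
# X3/X4 at an additive, potentially multiplicative prime: the TWIST STRUCTURE (where the twist lands)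

HONEST FRAMING (cell `b2b-bsdres`, run/shared/lean/b2b/bsd-rank1-residual/, verbatim in every
file): the goal of the cell is to DELETE the COMBINATION-SHAPED residual classes of the
Birch–Swinnerton-Dyer formula for ALL analytic-rank `≤ 1` elliptic curves over `ℚ` — "full BSD
formula for every rank `≤ 1` curve in class `C`" assembled STRICTLY from published theorems — so
that the rank-`≤ 1` remainder becomes exactly the CONSTRUCTION-SHAPED classes, which are TYPED
(missing-input `Prop`s), NOT attempted. This is not "finishing BSD". Sub-cell
`b2b-bsdres-additive-p1` (X3♯(M) / X4(M)); research route, no claim beyond the stated sub-classes.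

Theorems only. For `(E, p)` with `PotMult W p` (additive, `ord_p j < 0`):

* `PotMult.exists_twist_mult` — **some quadratic twist `E^{(d)}` has MULTIPLICATIVE reduction at
  `p`** (the tree's PROVED `exists_hasMultiplicativeReductionAt_quadraticTwist_of_one_lt_valuation_j`,
  Silverman *ATAEC* V.5.3 / *AEC* VII.5.5, X.5.4, transported from the place `v_p` of `ℤ` to the
  prime `p`: `Rat.HeightOneSpectrum.valuation_eq_exp_neg_padicValRat`,
  `hasMultiplicativeReductionAtPrime_iff_hasMultiplicativeReductionAt_holds`). Every residue
  characteristic, so `p = 3` (2208 of the 2392 X3 pairs `N < 2·10⁴`) is included.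
* `mult_of_model_twist` — multiplicative reduction passes to any `ℚ`-model `Wd` of the twist.
* `irr_iff_of_model_twist` — `E^{(d)}[p]` is irreducible iff `E[p]` is (the tree's
  `not_hasIrreducibleModPGaloisRep_twist`, Silverman *AEC* X.5.4, in both directions).
* `classX2_twist_of_classX3M` — **for `(E,p) ∈ X3♯(M)` the `p`-multiplicative twist is an X2 pair**
  (`p` odd, `E^{(d)}[p]` reducible, multiplicative): base-change-and-descend sends X3♯(M) to
  "X2 for the twist + the over-`K` input" — BOTH construction-shaped (honest: the route relocates,
  it does not delete).
* `mult_irr_twist_of_classX4M` — **for `(E,p) ∈ X4(M)` the twist is `p` odd ∧ mult ∧ irr**, i.e. in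
  the domain of Skinner 2016 Thm. C when moreover `L(E^{(d)},1) ≠ 0` and (ram) holds (COVERED, see
  `ClassTheorems.lean`), else in X11 (v5: X11a `¬ram`, X11b `r = 1`).
-/

noncomputable section

open scoped Classical

open WeierstrassCurve Literature.NumberTheory.EllipticCurves
  Literature.NumberTheory.EllipticCurves.Rank1Residual
  IsDedekindDomain

namespace Summit.BirchSwinnertonDyer.Rank1Residual.AdditivePotMult

variable {W : WeierstrassCurve ℚ} [W.IsElliptic] {p : ℕ} [Fact p.Prime]

/-- **A potentially multiplicative curve is a twist of a `p`-multiplicative one**: if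
`ord_p j(E) < 0` then some quadratic twist `E^{(d)}`, `d ∈ ℚ^×`, has multiplicative reduction at
`p` (Silverman *ATAEC* V.5.3, *AEC* VII.5.5 / X.5.4 — the tree's
`exists_hasMultiplicativeReductionAt_quadraticTwist_of_one_lt_valuation_j` at the place of `ℤ`
below `p`, moved to the prime-indexed predicate `Mult`). [folklore] -/
theorem PotMult.exists_twist_mult (h : PotMult W p) :
    ∃ d : ℚ, d ≠ 0 ∧ Mult (W.quadraticTwist d) p := by
  have hp : p.Prime := Fact.out
  set P : Nat.Primes := ⟨p, hp⟩ with hP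
  set v : HeightOneSpectrum ℤ := (Rat.HeightOneSpectrum.primesEquiv (R := ℤ)).symm P with hv_def
  have hv : Rat.HeightOneSpectrum.natGenerator v = p :=
    congrArg Subtype.val ((Rat.HeightOneSpectrum.primesEquiv (R := ℤ)).apply_symm_apply P)
  have hj0 : W.j ≠ 0 := by
    intro h0
    have := h.2
    rw [h0, padicValRat.zero] at this
    exact lt_irrefl _ this
  have hval : 1 < v.valuation ℚ W.j := by
    rw [Rat.HeightOneSpectrum.valuation_eq_exp_neg_padicValRat v hj0, hv, ← WithZero.exp_zero,
      WithZero.exp_lt_exp]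
    linarith [h.2]
  obtain ⟨d, hd0, hmult⟩ :=
    W.exists_hasMultiplicativeReductionAt_quadraticTwist_of_one_lt_valuation_j v hval
  refine ⟨d, hd0, ?_⟩
  haveI := W.isElliptic_quadraticTwist hd0
  exact ((W.quadraticTwist d).hasMultiplicativeReductionAtPrime_iff_hasMultiplicativeReductionAt_holds
    P).mpr hmult

/-- Multiplicative reduction at `p` passes to any `ℚ`-model `Wd = C • E^{(d)}` of the twist (a
property of the curve: `hasMultiplicativeReductionAtPrime_smul_iff`, Silverman *AEC* VII.5.1(b)).
[folklore] -/
theorem mult_of_model_twist {d : ℚ} (hd : d ≠ 0) (hmult : Mult (W.quadraticTwist d) p)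
    {Wd : WeierstrassCurve ℚ} (hWd : ∃ C : VariableChange ℚ, C • W.quadraticTwist d = Wd) :
    Mult Wd p := by
  obtain ⟨C, rfl⟩ := hWd
  haveI := W.isElliptic_quadraticTwist hd
  exact (hasMultiplicativeReductionAtPrime_smul_iff (W.quadraticTwist d) C p).mpr hmult

/-- **`E^{(d)}[p]` is irreducible iff `E[p]` is**, for any `ℚ`-model `Wd` of the twist: the twist
isomorphism over `ℚ(√d)` is `Γ_ℚ`-equivariant up to sign, so rational lines correspond (the tree's
`not_hasIrreducibleModPGaloisRep_twist`, Silverman *AEC* X.5.4, applied to `E ↦ E^{(d)}` and to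
`E^{(d)} ↦ (E^{(d)})^{(d)} = E^{(d²)} ≅ E`). [folklore] -/
theorem irr_iff_of_model_twist {d : ℚ} (hd : d ≠ 0) {Wd : WeierstrassCurve ℚ} [Wd.IsElliptic]
    (hWd : ∃ C : VariableChange ℚ, C • W.quadraticTwist d = Wd) : Irr Wd p ↔ Irr W p := by
  obtain ⟨C, hC⟩ := hWd
  constructor
  · intro hirr
    by_contra hred
    exact not_hasIrreducibleModPGaloisRep_twist (W := W) (p := p) hred hd Wd C⁻¹
      (by rw [← hC, inv_smul_smul]) hirr
  · intro hirr
    by_contra hred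
    -- `W` is a model of `Wd^{(d)} ≅ E^{(d²)} ≅ E`
    obtain ⟨C₁, hC₁⟩ := W.exists_variableChange_quadraticTwist_one
    obtain ⟨C₂, hC₂⟩ := W.exists_variableChange_quadraticTwist_mul_sq 1 d hd
    have h3 : Wd.quadraticTwist d =
        (⟨C.u, d * C.r, 0, 0⟩ : VariableChange ℚ) • W.quadraticTwist (d * d) := by
      rw [← hC, quadraticTwist_smul, quadraticTwist_quadraticTwist]
    have hmodel : ((⟨C.u, d * C.r, 0, 0⟩ : VariableChange ℚ) * C₂ * C₁) • W =
        Wd.quadraticTwist d := by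
      rw [mul_smul, mul_smul, hC₁, hC₂, h3, one_mul, sq]
    exact not_hasIrreducibleModPGaloisRep_twist (W := Wd) (p := p) hred hd W _ hmodel hirr

/-- Reducibility, the other reading: `E[p]` reducible ⇒ `E^{(d)}[p]` reducible on any model.
[folklore] -/
theorem red_of_model_twist {d : ℚ} (hd : d ≠ 0) {Wd : WeierstrassCurve ℚ} [Wd.IsElliptic]
    (hWd : ∃ C : VariableChange ℚ, C • W.quadraticTwist d = Wd) (hred : Red W p) : Red Wd p :=
  fun hirr => hred ((irr_iff_of_model_twist hd hWd).mp hirr)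

/-- **X3♯(M) ↦ X2 under the twist.** For `(E, p) ∈ X3♯(M)` and a `ℚ`-model `Wd` of a quadratic
twist `E^{(d)}` that is multiplicative at `p`: `(E^{(d)}, p) ∈ X2` (`p` odd, `E^{(d)}[p]` reducible,
multiplicative at `p`). So base-change-and-descend maps X3♯(M) to "class X2 for the twist + the
over-`K` input": both CONSTRUCTION-SHAPED — the route relocates the missing input, it deletes
nothing here. [folklore] -/
theorem classX2_twist_of_classX3M [W.IsGloballyMinimal] (hX : ClassX3M W p) {d : ℚ} (hd : d ≠ 0)
    {Wd : WeierstrassCurve ℚ} [Wd.IsElliptic]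
    (hWd : ∃ C : VariableChange ℚ, C • W.quadraticTwist d = Wd) (hmult : Mult Wd p) :
    ClassX2 Wd p :=
  ⟨hX.2.2, red_of_model_twist hd hWd hX.1.1, hmult⟩

/-- **X4(M) ↦ (odd `p`, multiplicative, irreducible) under the twist.** For `(E, p) ∈ X4(M)` and
a `ℚ`-model `Wd` of a quadratic twist multiplicative at `p`: `p ≠ 2 ∧ Mult Wd p ∧ Irr Wd p` — the
domain of Skinner 2016 Thm. C in analytic rank `0` with (ram) (COVERED), else class X11 (v5:
X11a `¬ram`, X11b `r = 1`). [folklore] -/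
theorem mult_irr_twist_of_classX4M (hX : ClassX4M W p) {d : ℚ} (hd : d ≠ 0)
    {Wd : WeierstrassCurve ℚ} [Wd.IsElliptic]
    (hWd : ∃ C : VariableChange ℚ, C • W.quadraticTwist d = Wd) (hmult : Mult Wd p) :
    p ≠ 2 ∧ Mult Wd p ∧ Irr Wd p :=
  ⟨hX.1.1, hmult, (irr_iff_of_model_twist hd hWd).mpr hX.1.2.2⟩

/-- The twist of an X4(M) pair, read against the v3 class X11: either the rank-0 (ram) cell of
Skinner 2016 Thm. C (`L(E^{(d)},1) ≠ 0 ∧ ram`) — not in X11 — or an X11 pair (`¬ram`, or analytic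
rank `1`: non-semistable or `p = 3` per v3; v5 files every multiplicative `r = 1` pair under
X11b). Here only the trichotomy on the tree's predicates is recorded: for the twist `Wd` of
analytic rank `≤ 1`, `(r = 0 ∧ Ram) ∨ ¬Ram ∨ r = 1`. [folklore] -/
theorem twist_trichotomy {Wd : WeierstrassCurve ℚ} [Wd.IsGloballyMinimal] (hrd : Wd.analyticRank ≤ 1) :
    (Wd.analyticRank = 0 ∧ Ram Wd p) ∨ ¬ Ram Wd p ∨ Wd.analyticRank = 1 := by
  rcases Nat.le_one_iff_eq_zero_or_eq_one.mp hrd with h0 | h1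
  · by_cases hram : Ram Wd p
    · exact Or.inl ⟨h0, hram⟩
    · exact Or.inr (Or.inl hram)
  · exact Or.inr (Or.inr h1)

end Summit.BirchSwinnertonDyer.Rank1Residual.AdditivePotMult

end
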